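import Summits.NavierStokesRegularity.NavierStokesRegularity.Theorems.TypeIDSSLiouvilleConjecture
import Summits.NavierStokesRegularity.NavierStokesRegularity.Theorems.LiouvilleConjectureNS
import Summits.NavierStokesRegularity.NavierStokesRegularity.Theorems.AxisymmetricLiouvilleBoundedSwirl
import HarnessLib

/-!
# Consequences of the Type I DSS Liouville conjecture (canonical statement)

Conjecture/notion split of 2026-08-15 (coordinator; migration item
`split:Literature.Analysis.FluidPDE.SelfSimilarLiouville#TypeIDSSLiouvilleConjecture`): the open
conjecture **ns.S26** is canonical at
`Summit.NavierStokesRegularity.NavierStokesRegularity.TypeIDSSLiouvilleConjecture` (conjecture LEAF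
`Summits/NavierStokesRegularity/NavierStokesRegularity/Theorems/TypeIDSSLiouvilleConjecture.lean`,
which imports `Literature/Analysis/FluidPDE/SelfSimilarLiouville.lean` for the notions
`TypeIDSSLiouville` / `RotatedTypeIDSSLiouville`); statements ABOUT the conjecture live here, stated
for the canonical name (step 2 of the migration; step 1, p64570, removed
`typeIDSSLiouvilleConjecture_iff` from `SelfSimilarLiouville.lean`; the earlier step-2 proposal
p64891 was lost to a gate restart and is re-filed here).

* `typeIDSSLiouvilleConjecture_iff` — the wall is equivalent to its rotated half: the plain
  `λ`-DSS conjunct is the case `R = 1` of the rotated one (`rotatedTypeIDSSLiouville_refl_iff`;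
  Bradshaw–Tsai 2017, §1: "when `φ ∈ 2πℤ` we recover `λ`-DSS vector fields").

A Literature file may import this Summits module only because it is a conjecture leaf (nothing but
the `@[conjecture] def`).

# The Liouville conjecture (L), its axisymmetric bounded-swirl case (AX-L), and KNSS's Theorem 5.2

Same split, migration item
`split:Literature.Analysis.FluidPDE.SelfSimilarLiouville#AxisymmetricLiouvilleBoundedSwirl`: the open
conjectures **ns.S22** (L) (Seregin–Šverák 2009, conjecture (L); Koch–Nadirashvili–Seregin–Šverák
2009, §1) and **ns.S25** (AX-L) (KNSS 2009, §5, arXiv p. 10; bounded-`Γ` form of Lei–Ren–Zhang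
arXiv:1902.11229, §1) are canonical at
`Summit.NavierStokesRegularity.NavierStokesRegularity.LiouvilleConjectureNS` and
`Summit.NavierStokesRegularity.NavierStokesRegularity.AxisymmetricLiouvilleBoundedSwirl` (conjecture LEAVES
under `Summits/NavierStokesRegularity/NavierStokesRegularity/Theorems/`, same definientia as the
transitional duplicates still declared in `SelfSimilarLiouville.lean`, which import only vocabulary
modules and which this file imports). The three theorems of `SelfSimilarLiouville.lean` relating the
two conjectures to each other and to the `ℝ³`-valued no-swirl theorem are carried here with the same
names and proofs, stated for the canonical conjectures (each enters only as a hypothesis; nothing is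
asserted about it):

* `LiouvilleConjectureNS.axisymmetric_no_swirl` — (L) contains the `ℝ³`-valued form of KNSS's
  Theorem 5.2 (axisymmetric, swirl-free bounded ancient mild solutions with measurable slices are
  spatially a.e. constant on every slice; KNSS 2009, §1 and §5);
* `LiouvilleConjectureNS.axisymmetricLiouvilleBoundedSwirl` — (L) implies (AX-L), its axisymmetric
  bounded-swirl special case (KNSS 2009, §5);
* `AxisymmetricLiouvilleBoundedSwirl.of_hasNoSwirl` — (AX-L) contains the `ℝ³`-valued no-swirl
  theorem (its case `Γ ≡ 0`; KNSS 2009, Thm 5.2).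

The seven further sanity implications of `SelfSimilarLiouville.lean` — (AX-L), hence (L), contains
each sub-case of (AX-L) proved in print (`AxisymmetricLiouvilleBoundedSwirl.knss2009_axisymmetric_no_swirl'`,
`….leiRenZhang2019_liouville_swirl_rate`, `….leiZhangZhao2017_liouville_swirl_decay`,
`….leiRenZhang2019_swirl_sup_at_infinity`, `LiouvilleConjectureNS.knss2009_axisymmetric_no_swirl'`,
`….leiRenZhang2019_liouville_swirl_rate`, `….leiZhangZhao2017_liouville_swirl_decay`) — stay in that
file under their names (their last name components are named facts discharged by importers, so the
gate's removal lint pins them there) and take the statement (L), resp. (AX-L), written out as their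
hypothesis; since that is the definiens of the canonical conjecture letter for letter, they apply
verbatim to `h : Summit.….AxisymmetricLiouvilleBoundedSwirl` / `hL : Summit.….LiouvilleConjectureNS`,
e.g. `AxisymmetricLiouvilleBoundedSwirl.leiRenZhang2019_liouville_swirl_rate h`.

Inside `namespace Literature.Analysis.FluidPDE` the short names `LiouvilleConjectureNS` /
`AxisymmetricLiouvilleBoundedSwirl` still denote the transitional duplicates, so the canonical
conjectures are written fully qualified; the theorem names keep the conjectures' prefixes, and with
`h : Summit.….AxisymmetricLiouvilleBoundedSwirl` one writes
`AxisymmetricLiouvilleBoundedSwirl.of_hasNoSwirl h …` (no dot-notation through the `Summit` name).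

References: G. Koch, N. Nadirashvili, G. Seregin, V. Šverák, Acta Math. 203 (2009) =
arXiv:0709.3599, §1, §5 (Theorem 5.2; the open problem stated after it, arXiv p. 10)
[KochNadirashviliSereginSverak2009]; G. Seregin, V. Šverák, Comm. PDE 34 (2009), §1, conjecture (L)
[SereginSverak2009]; Z. Lei, X. Ren, Q. S. Zhang, arXiv:1902.11229, §1 [LeiRenZhang2019].
-/

namespace Literature.Analysis.FluidPDE

/-- The Type I DSS Liouville wall (canonical
`Summit.NavierStokesRegularity.NavierStokesRegularity.TypeIDSSLiouvilleConjecture`: for every `λ`,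
the plain AND, for every `R ∈ O(3)`, the rotated Type I `λ`-DSS Liouville statement) is equivalent
to its rotated half alone, the plain statement being the case `R = 1`
(`rotatedTypeIDSSLiouville_refl_iff`). [cite: BradshawTsai2017CPDE, §1] -/
theorem typeIDSSLiouvilleConjecture_iff :
    Summit.NavierStokesRegularity.NavierStokesRegularity.TypeIDSSLiouvilleConjecture ↔
      ∀ (c : ℝ) (R : EuclideanSpace ℝ (Fin 3) ≃ₗᵢ[ℝ] EuclideanSpace ℝ (Fin 3)),
        RotatedTypeIDSSLiouville c R := by
  refine ⟨fun h c R => (h c).2 R, fun h c => ⟨?_, h c⟩⟩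
  exact (rotatedTypeIDSSLiouville_refl_iff c).1 (h c _)

/-- In particular the canonical wall implies the plain Type I `λ`-DSS Liouville statement for
every scaling factor. [folklore] -/
theorem typeIDSSLiouville_of_conjecture
    (h : Summit.NavierStokesRegularity.NavierStokesRegularity.TypeIDSSLiouvilleConjecture) (c : ℝ) :
    TypeIDSSLiouville c :=
  (h c).1

section LiouvilleConsequences

open MeasureTheory

/-! ## (L), (AX-L) and the `ℝ³`-valued no-swirl theorem (KNSS 2009, Thm 5.2) -/

/-- The Liouville conjecture (L) contains the (`ℝ³`-valued form of the) axisymmetric no-swirl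
theorem: under `LiouvilleConjectureNS`, an axisymmetric swirl-free bounded ancient mild solution
with measurable slices is spatially a.e. constant on every slice (sanity implication in the shape
of `knss_axisymmetric_no_swirl`, whose sharper conclusion `b(t) ∥ e_z` additionally uses the
symmetry; KNSS 2009, §1 and §5). The symmetry hypotheses are carried but not used. (Moved here from `SelfSimilarLiouville.lean` by the conjecture/notion split of 2026-08-15: same name and proof, stated for the canonical conjecture.) [cite: KochNadirashviliSereginSverak2009, §1 and §5] -/
theorem LiouvilleConjectureNS.axisymmetric_no_swirl
    (hL : Summit.NavierStokesRegularity.NavierStokesRegularity.LiouvilleConjectureNS)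
    {u : ℝ → EuclideanSpace ℝ (Fin 3) → EuclideanSpace ℝ (Fin 3)}
    (hu : FluidPDE.IsBoundedAncientMildSolution 1 u)
    (hmeas : ∀ t < 0, AEStronglyMeasurable (u t) volume)
    (_haxi : ∀ t < 0, FluidPDE.IsAxisymmetric (u t)) (_hswirl : ∀ t < 0, FluidPDE.HasNoSwirl (u t)) :
    ∀ t < 0, ∃ b : EuclideanSpace ℝ (Fin 3), u t =ᵐ[volume] fun _ => b :=
  hL u hu hmeas

/-- The Liouville conjecture (L) implies the bounded-swirl axisymmetric Liouville problem (AX-L)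
(KNSS 2009, §5: (AX-L) is the axisymmetric special case of (L)). (Moved here from `SelfSimilarLiouville.lean` by the conjecture/notion split of 2026-08-15: same name and proof, stated for the canonical conjecture.) [cite: KochNadirashviliSereginSverak2009, §5] -/
theorem LiouvilleConjectureNS.axisymmetricLiouvilleBoundedSwirl
    (hL : Summit.NavierStokesRegularity.NavierStokesRegularity.LiouvilleConjectureNS) :
    Summit.NavierStokesRegularity.NavierStokesRegularity.AxisymmetricLiouvilleBoundedSwirl :=
  fun u hu hmeas _ _ => hL u hu hmeas

/-- The no-swirl theorem (in its `ℝ³`-valued form) is the case `Γ ≡ 0` of (AX-L): under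
`AxisymmetricLiouvilleBoundedSwirl`, axisymmetric bounded ancient mild solutions with measurable
slices and without swirl are spatially a.e. constant on every slice (KNSS 2009, Thm 5.2 is thus a
special case of the open problem; sanity implication with a real proof). (Moved here from `SelfSimilarLiouville.lean` by the conjecture/notion split of 2026-08-15: same name and proof, stated for the canonical conjecture.) [cite: KochNadirashviliSereginSverak2009, Thm 5.2] -/
theorem AxisymmetricLiouvilleBoundedSwirl.of_hasNoSwirl
    (h : Summit.NavierStokesRegularity.NavierStokesRegularity.AxisymmetricLiouvilleBoundedSwirl)
    {u : ℝ → EuclideanSpace ℝ (Fin 3) → EuclideanSpace ℝ (Fin 3)}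
    (hu : FluidPDE.IsBoundedAncientMildSolution 1 u)
    (hmeas : ∀ t < 0, AEStronglyMeasurable (u t) volume)
    (haxi : ∀ t < 0, FluidPDE.IsAxisymmetric (u t)) (hswirl : ∀ t < 0, FluidPDE.HasNoSwirl (u t)) :
    ∀ t < 0, ∃ b : EuclideanSpace ℝ (Fin 3), u t =ᵐ[volume] fun _ => b :=
  h u hu hmeas haxi ⟨0, fun t ht x => by simp [hswirl t ht x]⟩

end LiouvilleConsequences

end Literature.Analysis.FluidPDE
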